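import Mathlib
import Literature.MathematicalPhysics.QuantumFieldTheory.BalabanImbrieJaffe1984to88.BIJ85Eq712Plancherel
import Literature.MathematicalPhysics.QuantumFieldTheory.BalabanImbrieJaffe1984to88.BIJ85MomentumSymbols71

/-!
# `BalabanImbrieJaffe1984to88.BIJ85Eq715ConfigSymbols` — T. Bałaban, J. Imbrie, A. Jaffe, *Renormalization of the Higgs
model: minimizers, propagators and the stability of mean field theory*, Commun. Math. Phys. **97** (1985) 299–329
[BalabanImbrieJaffe1985]: Sect. 7.1 p. 322 — **(7.1.5) from configuration space**: the unit-lattice translations, forward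
differences and curl on the finite unit torus T₁^{(k)}, and the PROOF that their momentum representations are the printed
symbols — `e^{ip_μ}`, (7.1.5) `∂^{(1)}_μ(p) = exp(ip_μ) − 1` (r15's `BIJ85MomentumSymbols71.dOne`) and, for the curl `f = ∂B`
of (7.1.13), `f̂_{λκ}(p) = ∂^{(1)}_λ(p)B̂_κ(p) − ∂^{(1)}_κ(p)B̂_λ(p)` (r15's `curlOne`) — at the reduced momentum `p_ν = 2πn_ν/N_ν`
(`B5Prop11Plancherel.sOf`) of every dual-torus point

statement-level skeleton of published theorems with citation tags; proofs where landed; nothing here is a claim about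
the Yang–Mills mass gap

PDF held: `paper:balaban1985-cmp97-bij-higgs-minimizers` (journal page = PDF page + 298).  Text read: PDF pp. 24–25
(journal 322–323).

CITATION HEADER (lean-in-tree rule).  Part of the lit-balaban TYPED SKELETON (HOME `run/shared/lean/pub/lit-balaban/`); WHAT IS
REPRODUCED: for SKELETON row **C1.Eq7.1.2-7.1.12** (`HOME/lit-balaban-r15/ROWS-C1.md`, owner r15, referee ref-5; cell: (7.1.4)–
(7.1.11) *"typed as defs with bodies"*) the display **(7.1.5)** p. 322 [PDF 24], verbatim: *"The unit lattice derivative ∂^{(1)}(p)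
is a similar matrix with eigenvalues ∂^{(1)}_μ(p) = exp(ip_μ) − 1. (7.1.5)"*, now as a THEOREM about the configuration-space
operator: the forward difference `(∂^{(1)}_μ f)(x) = f(x + e_μ) − f(x)` on multi-component fields over the unit torus has
momentum representation `dOne p μ · f̂(p)` (`dftC_fdiffC_mulVec`) and symbol `dOne p μ · 1` (`symb_fdiffC`); and for row
**C1.Eq7.1.13-7.1.19** (*"τ₁ vanishes on curls. Thus if f = ∂B, then τ₁f = 0"*, (7.1.13) p. 322, where r15's `curlOne` DEFINES
the momentum components of a curl) the configuration-space curl `(∂B)_{λκ}(x) = (∂^{(1)}_λB_κ)(x) − (∂^{(1)}_κB_λ)(x)` has momentum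
components `curlOne p B̂(p)` (`dftC_curlC_mulVec`).  TYPED READING: unit torus `Tor N`, fields `Tor N × m → ℂ`, F⊗1 = `dftC`
(`BIJ85Eq712Plancherel`); `p_ν` of a dual-torus point `q` is `sOf N q ν = 2π·valMinAbs(q_ν)/N_ν ∈ [−π, π]`, so
`e^{ip_ν} = stdAddChar(q_ν)` (`chi_unitVec_eq_exp`).  NOT CLAIMED: the η-lattice symbol (7.1.4) (needs the two-scale coset
decomposition `B5Prop11Plancherel.blockEquiv`; cf. `fsym_emb` there) and the averaging symbols (7.1.10)–(7.1.11).
Unit `lit-balaban-p27` (gen 4).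
-/

namespace Literature.MathematicalPhysics.QuantumFieldTheory.BalabanImbrieJaffe1984to88.BIJ85Eq715ConfigSymbols

open scoped BigOperators Matrix ComplexConjugate
open Finset Complex
open Literature.MathematicalPhysics.QuantumFieldTheory.Balaban1983to89.B5Prop11Plancherel
open Literature.MathematicalPhysics.QuantumFieldTheory.BalabanImbrieJaffe1984to88.BIJ85Eq712Plancherel
open Literature.MathematicalPhysics.QuantumFieldTheory.BalabanImbrieJaffe1984to88.BIJ85MomentumSymbols71

noncomputable section

variable {d : ℕ} (N : Fin d → ℕ) [hN : ∀ μ, NeZero (N μ)] (m : Type*) [Fintype m] [DecidableEq m]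

/-! ## §1 The Fourier transform entrywise; translations become phases -/

/-- `((F⊗1) g)(p, i) = Σ_x F_{p,x} g(x, i)` (API of the (7.1.2) Fourier transform). [cite: BalabanImbrieJaffe1985, (7.1.2) p.321] -/
theorem dftC_mulVec_apply (g : Tor N × m → ℂ) (p : Tor N) (i : m) :
    (dftC N m *ᵥ g) (p, i) = ∑ x : Tor N, dft N p x * g (x, i) := by
  simp only [Matrix.mulVec, dotProduct]
  rw [Fintype.sum_prod_type]
  refine Finset.sum_congr rfl fun x _ => ?_
  rw [Finset.sum_eq_single i]
  · rw [dftC_apply, if_pos rfl]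
  · intro j _ hj
    rw [dftC_apply, if_neg (Ne.symm hj), zero_mul]
  · exact fun h => absurd (Finset.mem_univ i) h

/-- A unit-lattice translation becomes the phase `e^{ip_ν}` in momentum space: `Σ_x F_{p,x} g(x + e_ν, i) = e^{ip·e_ν} ĝ_i(p)`.
[cite: BalabanImbrieJaffe1985, (7.1.5) p.322] -/
theorem sum_dft_mul_shift (g : Tor N × m → ℂ) (p : Tor N) (i : m) (ν : Fin d) :
    ∑ x : Tor N, dft N p x * g (x + unitVec N ν, i) = chi N p (unitVec N ν) * (dftC N m *ᵥ g) (p, i) := by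
  rw [dftC_mulVec_apply, Finset.mul_sum]
  refine Fintype.sum_equiv (Equiv.addRight (unitVec N ν)) _ _ fun x => ?_
  show dft N p x * g (x + unitVec N ν, i)
    = chi N p (unitVec N ν) * (dft N p (x + unitVec N ν) * g (x + unitVec N ν, i))
  rw [chi_unitVec, ← mul_assoc, ← dft_sub_unitVec, add_sub_cancel_right]

/-- **`e^{ip_ν}` at a dual-torus point**: the character value `e^{ip·e_ν}` of `q ∈ T̃₁` is `exp(i p_ν)` with the reduced real
momentum `p_ν = 2π n_ν/N_ν ∈ [−π, π]` (`B5Prop11Plancherel.sOf`; *"|p_i| ≤ π"* p. 321). [cite: BalabanImbrieJaffe1985, (7.1.5) p.322] -/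
theorem chi_unitVec_eq_exp (q : Tor N) (ν : Fin d) :
    chi N q (unitVec N ν) = Complex.exp (Complex.I * ((sOf N q ν : ℝ) : ℂ)) := by
  rw [chi_unitVec, ← ZMod.coe_valMinAbs (q ν), ZMod.stdAddChar_coe]
  simp only [sOf]
  congr 1
  push_cast
  ring

/-! ## §2 Unit-lattice translations `S_ν` on multi-component fields -/

/-- The unit-lattice translation `(S_ν f)(x, i) = f(x + e_ν, i)` on multi-component fields over the unit torus (the building
block of ∂^{(1)}; *"σ_k is translation invariant"* p. 321). [cite: BalabanImbrieJaffe1985, (7.1.5) p.322] -/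
def shiftC (ν : Fin d) : Matrix (Tor N × m) (Tor N × m) ℂ :=
  Matrix.of fun a b => if b = (a.1 + unitVec N ν, a.2) then 1 else 0

/-- `(S_ν f)(x, i) = f(x + e_ν, i)`. [cite: BalabanImbrieJaffe1985, (7.1.5) p.322] -/
theorem shiftC_mulVec (ν : Fin d) (f : Tor N × m → ℂ) (x : Tor N) (i : m) :
    (shiftC N m ν *ᵥ f) (x, i) = f (x + unitVec N ν, i) := by
  simp only [Matrix.mulVec, dotProduct]
  rw [Finset.sum_eq_single (x + unitVec N ν, i)]
  · simp [shiftC]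
  · intro b _ hb
    simp [shiftC, hb]
  · exact fun h => absurd (Finset.mem_univ _) h

omit hN [Fintype m] in
/-- `S_ν` is translation invariant. [cite: BalabanImbrieJaffe1985, (7.1.5) p.322] -/
theorem isTranslInv_shiftC (ν : Fin d) : IsTranslInv N m (shiftC N m ν) := by
  intro a x y i j
  simp only [shiftC, Matrix.of_apply, Prod.mk.injEq, add_right_comm x a (unitVec N ν), add_left_inj]

/-- `(F⊗1)(S_ν f)(p, i) = e^{ip·e_ν} f̂_i(p)`. [cite: BalabanImbrieJaffe1985, (7.1.5) p.322] -/
theorem dftC_shiftC_mulVec (ν : Fin d) (f : Tor N × m → ℂ) (p : Tor N) (i : m) :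
    (dftC N m *ᵥ (shiftC N m ν *ᵥ f)) (p, i) = chi N p (unitVec N ν) * (dftC N m *ᵥ f) (p, i) := by
  rw [dftC_mulVec_apply]
  simp_rw [shiftC_mulVec]
  exact sum_dft_mul_shift N m f p i ν

omit [Fintype m] in
/-- The symbol of `S_ν` is the scalar `e^{ip·e_ν}`: `symb S_ν p = e^{ip·e_ν}·1`. [cite: BalabanImbrieJaffe1985, (7.1.5) p.322] -/
theorem symb_shiftC (ν : Fin d) (p : Tor N) :
    symb N m (shiftC N m ν) p = chi N p (unitVec N ν) • (1 : Matrix m m ℂ) := by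
  ext i j
  rw [symb_apply, Finset.sum_eq_single (-unitVec N ν)]
  · rw [Matrix.smul_apply, Matrix.one_apply, smul_eq_mul, conj_chi, chi_neg_neg]
    simp only [shiftC, Matrix.of_apply, Prod.mk.injEq, neg_add_cancel, true_and]
    by_cases h : j = i
    · subst h; simp
    · simp [h, Ne.symm h]
  · intro z _ hz
    rw [shiftC, Matrix.of_apply, if_neg (fun e => hz (eq_neg_of_add_eq_zero_left ((Prod.mk.inj e).1).symm)),
      zero_mul]
  · exact fun h => absurd (Finset.mem_univ _) h

/-! ## §3 (7.1.5): the unit-lattice forward difference and its symbol `∂^{(1)}_ν(p) = e^{ip_ν} − 1` -/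

/-- The unit-lattice forward difference `∂^{(1)}_ν = S_ν − I` on multi-component fields: `(∂^{(1)}_ν f)(x,i) = f(x+e_ν,i) −
f(x,i)` (*"We use a superscript (1) to denote the unit lattice scale"*, p. 322). [cite: BalabanImbrieJaffe1985, (7.1.5) p.322] -/
def fdiffC (ν : Fin d) : Matrix (Tor N × m) (Tor N × m) ℂ := shiftC N m ν - 1

/-- `(∂^{(1)}_ν f)(x, i) = f(x + e_ν, i) − f(x, i)`. [cite: BalabanImbrieJaffe1985, (7.1.5) p.322] -/
theorem fdiffC_mulVec (ν : Fin d) (f : Tor N × m → ℂ) (x : Tor N) (i : m) :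
    (fdiffC N m ν *ᵥ f) (x, i) = f (x + unitVec N ν, i) - f (x, i) := by
  rw [fdiffC, Matrix.sub_mulVec, Pi.sub_apply, shiftC_mulVec, Matrix.one_mulVec]

omit hN [Fintype m] in
/-- `∂^{(1)}_ν` is translation invariant. [cite: BalabanImbrieJaffe1985, (7.1.5) p.322] -/
theorem isTranslInv_fdiffC (ν : Fin d) : IsTranslInv N m (fdiffC N m ν) := by
  intro a x y i j
  rw [fdiffC, Matrix.sub_apply, Matrix.sub_apply, isTranslInv_shiftC N m ν a x y i j, Matrix.one_apply,
    Matrix.one_apply]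
  simp only [Prod.mk.injEq, add_left_inj]

/-- **(7.1.5)** p. 322 [PDF 24], verbatim: *"The unit lattice derivative ∂^{(1)}(p) is a similar matrix with eigenvalues
∂^{(1)}_μ(p) = exp(ip_μ) − 1. (7.1.5)"* — PROVED for the configuration-space operator: `(F⊗1)(∂^{(1)}_ν f)(q, i) =
(exp(ip_ν) − 1)·f̂_i(q) = dOne p ν · f̂_i(q)`, `p = sOf N q` the reduced momentum of the dual-torus point `q` (r15's `dOne`).
[cite: BalabanImbrieJaffe1985, (7.1.5) p.322] -/
theorem dftC_fdiffC_mulVec (ν : Fin d) (f : Tor N × m → ℂ) (q : Tor N) (i : m) :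
    (dftC N m *ᵥ (fdiffC N m ν *ᵥ f)) (q, i) = dOne (sOf N q) ν * (dftC N m *ᵥ f) (q, i) := by
  rw [dftC_mulVec_apply]
  simp_rw [fdiffC_mulVec, mul_sub]
  rw [Finset.sum_sub_distrib, sum_dft_mul_shift, ← dftC_mulVec_apply N m f q i, chi_unitVec_eq_exp, dOne, sub_mul,
    one_mul]

omit [Fintype m] in
/-- kernel: the symbol of the identity, entrywise. [folklore] -/
private theorem sum_one_apply_mul_conj_chi (p : Tor N) (i j : m) :
    ∑ z : Tor N, (1 : Matrix (Tor N × m) (Tor N × m) ℂ) (z, i) (0, j) * conj (chi N p z) = if i = j then 1 else 0 := by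
  rw [Finset.sum_eq_single (0 : Tor N)]
  · rw [Matrix.one_apply]
    simp only [Prod.mk.injEq, true_and, chi_zero_right', map_one, mul_one]
  · intro z _ hz
    rw [Matrix.one_apply, if_neg (fun e => hz (Prod.mk.inj e).1), zero_mul]
  · exact fun h => absurd (Finset.mem_univ _) h
  where
  /-- kernel: `e^{ip·0} = 1`. [folklore] -/
  chi_zero_right' : chi N p 0 = 1 := by unfold chi; simp

omit [Fintype m] in
/-- **(7.1.5) as a symbol**: `symb ∂^{(1)}_ν q = (exp(ip_ν) − 1)·1 = dOne (sOf N q) ν · 1` — ∂^{(1)} *"is a … matrix with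
eigenvalues ∂^{(1)}_μ(p) = exp(ip_μ) − 1"*, diagonal in the components. [cite: BalabanImbrieJaffe1985, (7.1.5) p.322] -/
theorem symb_fdiffC (ν : Fin d) (q : Tor N) : symb N m (fdiffC N m ν) q = dOne (sOf N q) ν • (1 : Matrix m m ℂ) := by
  have hS := symb_shiftC N m ν q
  ext i j
  have hSij := congrFun (congrFun hS i) j
  rw [symb_apply] at hSij ⊢
  rw [Matrix.smul_apply, Matrix.one_apply, smul_eq_mul] at hSij ⊢
  simp_rw [fdiffC, Matrix.sub_apply, sub_mul]
  rw [Finset.sum_sub_distrib, hSij, sum_one_apply_mul_conj_chi, chi_unitVec_eq_exp, dOne]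
  ring

/-! ## §4 The unit-lattice curl `f = ∂B` and its momentum components (r15's `curlOne`) -/

/-- The unit-lattice curl (exterior derivative on bond fields), configuration space: for a 1-form `B : Tor N × Fin d → ℂ`,
`(∂B)_{λκ}(x) = (∂^{(1)}_λ B_κ)(x) − (∂^{(1)}_κ B_λ)(x) = B_κ(x+e_λ) − B_κ(x) − B_λ(x+e_κ) + B_λ(x)`, a 2-form with components indexed
by ordered pairs (λ, κ) (*"if f = ∂B"*, (7.1.13); antisymmetric, `curlC_mulVec_swap`). [cite: BalabanImbrieJaffe1985, (7.1.13) p.322] -/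
def curlC : Matrix (Tor N × (Fin d × Fin d)) (Tor N × Fin d) ℂ :=
  Matrix.of fun a b =>
    ((if b = (a.1 + unitVec N a.2.1, a.2.2) then 1 else 0) - (if b = (a.1, a.2.2) then 1 else 0))
      - ((if b = (a.1 + unitVec N a.2.2, a.2.1) then 1 else 0) - (if b = (a.1, a.2.1) then 1 else 0))

/-- `(∂B)_{λκ}(x) = (B_κ(x+e_λ) − B_κ(x)) − (B_λ(x+e_κ) − B_λ(x))`. [cite: BalabanImbrieJaffe1985, (7.1.13) p.322] -/
theorem curlC_mulVec (B : Tor N × Fin d → ℂ) (x : Tor N) (l κ : Fin d) :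
    (curlC N *ᵥ B) (x, (l, κ))
      = (B (x + unitVec N l, κ) - B (x, κ)) - (B (x + unitVec N κ, l) - B (x, l)) := by
  simp only [Matrix.mulVec, dotProduct, curlC, Matrix.of_apply, sub_mul, ite_mul, one_mul, zero_mul,
    Finset.sum_sub_distrib, Finset.sum_ite_eq', Finset.mem_univ, if_true]

/-- `∂B` is antisymmetric: `(∂B)_{κλ} = −(∂B)_{λκ}` (a two-form, *"antisymmetric functions on coordinate axes μ, ν"* p. 321).
[cite: BalabanImbrieJaffe1985, (7.1.13) p.322] -/
theorem curlC_mulVec_swap (B : Tor N × Fin d → ℂ) (x : Tor N) (l κ : Fin d) :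
    (curlC N *ᵥ B) (x, (κ, l)) = -(curlC N *ᵥ B) (x, (l, κ)) := by
  rw [curlC_mulVec, curlC_mulVec]
  ring

/-- **The momentum components of a curl**: if `f = ∂B` (configuration space) then `f̂_{λκ}(q) = ∂^{(1)}_λ(p)B̂_κ(q) −
∂^{(1)}_κ(p)B̂_λ(q) = curlOne p B̂(q) λ κ`, `p = sOf N q` — the configuration-space meaning of r15's `curlOne`, under which *"if
f = ∂B, then τ₁f = 0"* (7.1.13) is read in momentum space (`BIJ85MomentumSymbols71.tau1Sym_curl`).
[cite: BalabanImbrieJaffe1985, (7.1.13) p.322] -/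
theorem dftC_curlC_mulVec (B : Tor N × Fin d → ℂ) (q : Tor N) (l κ : Fin d) :
    (dftC N (Fin d × Fin d) *ᵥ (curlC N *ᵥ B)) (q, (l, κ))
      = curlOne (sOf N q) (fun μ => (dftC N (Fin d) *ᵥ B) (q, μ)) l κ := by
  rw [dftC_mulVec_apply]
  simp_rw [curlC_mulVec, mul_sub, Finset.sum_sub_distrib]
  rw [sum_dft_mul_shift, sum_dft_mul_shift, ← dftC_mulVec_apply N (Fin d) B q κ, ← dftC_mulVec_apply N (Fin d) B q l,
    chi_unitVec_eq_exp, chi_unitVec_eq_exp]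
  simp only [curlOne, dOne]
  ring

end

end Literature.MathematicalPhysics.QuantumFieldTheory.BalabanImbrieJaffe1984to88.BIJ85Eq715ConfigSymbols
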